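import Summits.NavierStokesRegularity.NavierStokesRegularity.Theses.SqueezeCycle
import Summits.NavierStokesRegularity.NavierStokesRegularity.Theorems.RecurrentProfilesRecurrentReduction
import Summits.NavierStokesRegularity.NavierStokesRegularity.Theorems.SqueezeCycleRecurrentLiouvilleSmallHullRemoval
import Literature.Analysis.FluidPDE.ScalingUniformRecurrence

/-!
# `RecurrentLiouville` (crux stmt-NavierStokesRegularity-1589), line Sketch: the residual stub
# `stub_rlResidualCore` is crux-complete — negative-side support (cdisprove, gen 2)

Line Sketch (card `rung-neighbourhoods`, lead prover-line-stmt-NavierStokesRegularity-1589-0)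
splits the crux `SqueezeCycle.RecurrentLiouville` in the class `𝒮(C,M)` (suitable weak on the
backward slab, weak gradient, `𝐈 ≤ M < ⊤`, rate `C/√(−t)`) into

* Branch A `stub_rlSmallHullRemoval`: `∃ δ(C,M) > 0`, every member whose whole scaling orbit is
  `δ`-close to itself in `L³(Q(0,1))` is regular at the origin (`SmallHullsRemovable C M δ`), and
* the residual stub S5 `stub_rlResidualCore`: assuming small hulls are removable at `(C,M,δ)`,
  every uniformly RECURRENT member with a NON-`δ`-small orbit is regular.

This file records, as a checked theorem, that S5 is not a reduction but a RESTATEMENT of the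
crux: modulo Branch A, `¬ S5 ↔ ¬ RecurrentLiouville` (`residualCore_false_iff`), and — Branch A
being the landed `stub_rlSmallHullRemoval` — unconditionally
(`residualCore_false_iff_recurrentLiouville_false`). The non-trivial
direction: a counterexample to the crux is a Type-I singularity model; the PROVED reduction
`recurrentReduction_proof` (item stmt-NavierStokesRegularity-1590) makes it uniformly recurrent
with the same rate; at its own level `M := 𝐈(w)` Branch A hands out `δ > 0`, and the singular `w`
cannot have a `δ`-small orbit (it would be regular) — so `w` meets every hypothesis of S5 and
violates its conclusion. Consequently no lever of the line touches S5, a kill of S5 is a kill of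
the crux (an explicit Type-I singularity model, Albritton–Barker class), and `promote-stub` is
the right call for the lead.

## References

* D. Albritton, T. Barker, J. Math. Fluid Mech. 21 (2019), Thm. 1.1, Prop. 2.3. [AlbrittonBarker2019]
* H. Furstenberg, Recurrence in Ergodic Theory and Combinatorial Number Theory (1981), Thm. 1.16.
  [Furstenberg1981]
-/

noncomputable section

open MeasureTheory TopologicalSpace Set Function Filter Topology Metric
open scoped InnerProductSpace RealInnerProductSpace ENNReal NNReal
open Literature.Analysis.FluidPDE
open Summit.NavierStokesRegularity.NavierStokesRegularity.Theses

set_option linter.dupNamespace false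

namespace Summit.NavierStokesRegularity.NavierStokesRegularity.Theorems.RecurrentLiouville.Negative

/-- Physical space. -/
local notation "ℝ³" => EuclideanSpace ℝ (Fin 3)

/-- The open backward slab `(-∞,0) × ℝ³` (time first), as in the route file. -/
local notation "𝕊" => Literature.Analysis.FluidPDE.slab (EuclideanSpace ℝ (Fin 3)) (Set.Iio (0 : ℝ)) isOpen_Iio

/-- `L³` on the unit backward cylinder `Q(0,1)` — the metric of line Sketch. -/
local notation "μ₁" => (volume.restrict (parabolicCylinder 1 (0 : ℝ × EuclideanSpace ℝ (Fin 3))) :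
  Measure (ℝ × EuclideanSpace ℝ (Fin 3)))

/-- "`δ`-small scaling hulls are removable in `𝒮(C,M)`": the property that appears verbatim as a
HYPOTHESIS of the registered stub `stub_rlResidualCore` and, behind `∃ δ > 0`, as the CONCLUSION
of the registered stub `stub_rlSmallHullRemoval` (Branch A of line Sketch). -/
def SmallHullsRemovable (C : ℝ) (M : ℝ≥0∞) (δ : ℝ) : Prop :=
  ∀ (v : ℝ → ℝ³ → ℝ³) (q : ℝ → ℝ³ → ℝ) (H : ℝ → ℝ³ → ℝ³ →L[ℝ] ℝ³),
    IsSuitableWeakSolutionOn 𝕊 1 0 v q → HasWeakSpatialGradientOn 𝕊 v H →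
    typeIBound (Iio (0 : ℝ) ×ˢ univ) v q H ≤ M → HasTypeITimeDecay C v →
    (∀ σ : ℝ, eLpNorm (uncurry (nsRescale (Real.exp σ) v) - uncurry v) 3 μ₁ ≤ ENNReal.ofReal δ) →
    ¬ IsBackwardSingularPoint v 0

/-- The content of the registered stub `stub_rlSmallHullRemoval` (Branch A). -/
def SmallHullRemovalStmt : Prop :=
  ∀ (C : ℝ) (M : ℝ≥0∞), M < ⊤ → ∃ δ : ℝ, 0 < δ ∧ SmallHullsRemovable C M δ

/-- The content of the registered stub `stub_rlResidualCore` (S5), with the inline removability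
hypothesis abbreviated to `SmallHullsRemovable C M δ` (definitionally equal, see the `example`). -/
def ResidualCoreStmt : Prop :=
  ∀ (C : ℝ) (M : ℝ≥0∞) (δ : ℝ), M < ⊤ → 0 < δ → SmallHullsRemovable C M δ →
    ∀ (u : ℝ → ℝ³ → ℝ³) (p : ℝ → ℝ³ → ℝ) (G : ℝ → ℝ³ → ℝ³ →L[ℝ] ℝ³),
      IsSuitableWeakSolutionOn 𝕊 1 0 u p → HasWeakSpatialGradientOn 𝕊 u G →
      typeIBound (Iio (0 : ℝ) ×ˢ univ) u p G ≤ M → HasTypeITimeDecay C u →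
      IsScalingUniformlyRecurrent u →
      (∃ σ : ℝ, ENNReal.ofReal δ < eLpNorm (uncurry (nsRescale (Real.exp σ) u) - uncurry u) 3 μ₁) →
      ¬ IsBackwardSingularPoint u 0

/-- Sanity: `ResidualCoreStmt` is the registered signature of `stub_rlResidualCore`, letter for
letter up to unfolding `SmallHullsRemovable`. -/
example : ResidualCoreStmt ↔
    ∀ (C : ℝ) (M : ℝ≥0∞) (δ : ℝ), M < ⊤ → 0 < δ → (∀ (v : ℝ → EuclideanSpace ℝ (Fin 3) → EuclideanSpace ℝ (Fin 3)) (q : ℝ → EuclideanSpace ℝ (Fin 3) → ℝ) (H : ℝ → EuclideanSpace ℝ (Fin 3) → EuclideanSpace ℝ (Fin 3) →L[ℝ] EuclideanSpace ℝ (Fin 3)), IsSuitableWeakSolutionOn (slab (EuclideanSpace ℝ (Fin 3)) (Iio 0) isOpen_Iio) 1 0 v q → HasWeakSpatialGradientOn (slab (EuclideanSpace ℝ (Fin 3)) (Iio 0) isOpen_Iio) v H → typeIBound (Iio (0 : ℝ) ×ˢ univ) v q H ≤ M → HasTypeITimeDecay C v → (∀ σ : ℝ, eLpNorm (uncurry (nsRescale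 (Real.exp σ) v) - uncurry v) 3 (volume.restrict (parabolicCylinder 1 (0 : ℝ × EuclideanSpace ℝ (Fin 3)))) ≤ ENNReal.ofReal δ) → ¬ IsBackwardSingularPoint v 0) → ∀ (u : ℝ → EuclideanSpace ℝ (Fin 3) → EuclideanSpace ℝ (Fin 3)) (p : ℝ → EuclideanSpace ℝ (Fin 3) → ℝ) (G : ℝ → EuclideanSpace ℝ (Fin 3) → EuclideanSpace ℝ (Fin 3) →L[ℝ] EuclideanSpace ℝ (Fin 3)), IsSuitableWeakSolutionOn (slab (EuclideanSpace ℝ (Fin 3)) (Iio 0) isOpen_Iio) 1 0 u p → HasWeakSpatialGradientOn (slab (EuclideanSpace ℝ (Fin 3)) (Iio 0) isOpen_Iio) u G → typeIBound (Iio (0 : ℝ) ×ˢ univ) u p G ≤ M → HasTypeITimeDecay C u → IsScalingUniformlyRecurrent u → (∃ σ : ℝ, ENNReal.ofReal δ < eLpNorm (uncurry (nsRescale (Real.exp σ) u) - uncurry u) 3 (volume.restrict (parabolicCylinder 1 (0 : ℝ × EuclideanSpace ℝ (Fin 3))))) → ¬ IsBackwardSingularPoint u 0 :=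
  Iff.rfl

/-- **The residual core is crux-complete (modulo Branch A).** `¬ S5 ↔ ¬ RecurrentLiouville`.
(→) S5 is a special case of the crux (it only adds the hypotheses `𝐈 ≤ M < ⊤`, non-small orbit).
(←) a counterexample `(u,p,G,C)` to the crux is a Type-I singularity model; make it uniformly
recurrent with the same rate (`recurrentReduction_proof`, item 1590), put `M := 𝐈(w) < ⊤` and
take `δ := δ(C,M)` from Branch A; the singular `w` has no `δ`-small orbit (else Branch A would make
it regular), so it satisfies every hypothesis of S5 and violates its conclusion.
[cite: AlbrittonBarker2019, Thm. 1.1, Prop. 2.3] -/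
theorem residualCore_false_iff (hSHR : SmallHullRemovalStmt) :
    ¬ ResidualCoreStmt ↔ ¬ SqueezeCycle.RecurrentLiouville := by
  constructor
  · -- S5 is a special case of the crux
    intro h5 hcrux
    exact h5 fun C _M _δ hM _hδ _hR u p G hsw hwg hI hdec hrec _hσ =>
      hcrux u p G C hsw hwg (lt_of_le_of_lt hI hM) hdec hrec
  · intro hcrux hS5
    refine hcrux fun u p G C hsw hwg hI hdec _ hsing => ?_
    -- a singularity model; make it recurrent, same rate
    obtain ⟨w, q, H, hsw', hwg', hI', hdec', hsing', hrec'⟩ :=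
      recurrentReduction_proof u p G C hsw hwg hI hdec hsing
    -- Branch A at the level `M = 𝐈(w)`
    obtain ⟨δ, hδ, hR⟩ := hSHR C (typeIBound (Iio (0 : ℝ) ×ˢ univ) w q H) hI'
    -- the orbit of the singular `w` is not `δ`-small
    have hσ : ∃ σ : ℝ, ENNReal.ofReal δ <
        eLpNorm (uncurry (nsRescale (Real.exp σ) w) - uncurry w) 3 μ₁ := by
      by_contra hno
      push Not at hno
      exact hR w q H hsw' hwg' le_rfl hdec' hno hsing'
    -- so S5 applies to `w` and declares it regular
    exact hS5 C _ δ hI' hδ hR w q H hsw' hwg' le_rfl hdec' hrec' hσ hsing'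


/-- **Unconditional form.** Branch A is the landed theorem `stub_rlSmallHullRemoval` (p117043), so
`¬ S5 ↔ ¬ RecurrentLiouville` outright: the STUCK stub of line Sketch carries the whole crux.
[cite: AlbrittonBarker2019, Thm. 1.1, Prop. 2.3] -/
theorem residualCore_false_iff_recurrentLiouville_false :
    ¬ ResidualCoreStmt ↔ ¬ SqueezeCycle.RecurrentLiouville :=
  residualCore_false_iff fun C M hM => stub_rlSmallHullRemoval C M hM

end Summit.NavierStokesRegularity.NavierStokesRegularity.Theorems.RecurrentLiouville.Negative

end
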